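import Summits.QuantumFields.BalabanUV.Beta.GAN24.DepthTowerPrefactors

/-!
# `BalabanUV.Beta.GAN24.FaceReadCrossedValueZeroPin` — binder row G-an2-4 ∕ (CONV-C), W-slot (α-0), typer's PART VI row **T6-VAL**, the (γ) hand's letter **K7-0 AT THE PINS**: the
# right-hand side of this hand's `FaceReadCrossedValueZeroClosed.crossed_faceRead_dressedStep_zero_closedE0` (road-P2's literal crossed LS face read of the level-0 dressed source, `E2 d Lc 0`
# half closed) is, as a polynomial identity in its letters, AT THE PINS `d = 3`, `sf = sm = 1`, `stepScale 3 Lc 0 = 1`, `wVH 3 Lc 0 = 1` (`DepthTowerPrefactors.units_eq` at `j = 0`),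
# `cE = Lc⁴`, `c = cE₂·Lc⁸`, `cE₂ = Lc⁸`, `M = Lc·P`:  `= −4·Lc⁸·(M² − 1) − Lc¹⁶·(B₁ + B₂)` — leaf-03 g72's `CrossedLedgerClosure.valLedger_all_iff_target_pin` letter `hface0 : Xf 0 m = W m − G 1 m`
# with EXACTLY its target number `W m = −4·Lc⁸·(Lc²·(P m)² − 1)` and `G 1 m = Lc¹⁶·(B₁ + B₂)`, `B₁, B₂` the two `E2 3 Lc 1` cell pairings of K2's face profiles at period `P m` (symbolic)
# (G-an2-4 CRUX TEAM (2), seat `b2b-balaban-gan24-formalise-leaf-06` = the (γ) hand, gen 57; journal [GAN24LEAF06-G57-INTENT-7]; memo `g57/K7-ZERO-g57.md` §3∕§7)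

[folklore] arithmetic (`subst`, `field_simp`, `ring`); 0 `def`, 0 cited fact, 0 `def … : Prop`, 0 sorry.  HONEST FRAMING (cell contract, verbatim): «discharging `BetaPertH` makes Bałaban's UV
stability UNCONDITIONAL — a real constructive-QFT result; it is NOT the continuum limit and NOT the Clay problem.»  HONEST DEPENDENCY (verbatim): «continuum YM on T⁴ ⇐ BetaPertH ∧ nine spine
estimates (0/9 proved); BetaPertH ⇐ (D1) ∧ (D4) ∧ CAP+tail; G-an2-4 gates asym, D1 and NE2/3/4.»  A statement about real numbers only: it is NOT `hXu` (that is leaf-03's ledger over all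
levels with `G (k+1) m` from levels `≥ 1`), asserts nothing about any kernel; discharges NOTHING of `hX` ∕ (C) ∕ `hB0` ∕ `hBF` ∕ (Q-L); NEVER «G-an2-4 closed» as (CONV-C); NOT D1, NOT
`BetaPertH`, NOT continuum, NOT Clay.  2026-08-24; no existing file touched.
-/

noncomputable section

namespace Summit.QuantumFields.BalabanUV.Beta.GAN24.FaceReadCrossedValueZeroPin

/-- [folklore] **K7-0 AT THE PINS** (module docstring): the letters of `crossed_faceRead_dressedStep_zero_closedE0`'s right-hand side at `d = 3` — `K = sf·sm·(ss·Lc⁴)⁻¹` with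
`ss = stepScale 3 Lc 0 = 1`, `w = wVH 3 Lc 0 = 1`, `sf = sm = 1`, `cE = Lc⁴`, `c = cE₂·Lc⁸`, `cE₂ = Lc⁸` — give `−4·Lc⁸·(M² − 1) − Lc¹⁶·(B₁ + B₂)`. -/
theorem pin_levelZero_crossed {Lc M sf sm ss w cE cE₂ c : ℝ} (hLc : Lc ≠ 0) (hM : M ≠ 0) (hsf : sf = 1) (hsm : sm = 1) (hss : ss = 1) (hw : w = 1)
    (hcE : cE = Lc ^ (3 + 1)) (hcE₂ : cE₂ = Lc ^ (2 * (3 + 1))) (hc : c = cE₂ * Lc ^ (2 * (3 + 1))) (B₁ B₂ : ℝ) :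
    4 * ((c * -(((sf * sm) * (ss * Lc ^ (3 + 1))⁻¹) * ((sf * sm) * (ss * Lc ^ (3 + 1))⁻¹))) * (((sf * sm) * (ss * Lc ^ (3 + 1))⁻¹) * ((sf * sm) * (ss * Lc ^ (3 + 1))⁻¹))) *
        ((((sf * sm)⁻¹ * (sf⁻¹ * sf⁻¹) * cE) * ((sf * sm)⁻¹ * (sf⁻¹ * sf⁻¹) * cE)) *
            ((-(1 / 2 : ℝ)) * (1 / 2 : ℝ) * ((sf * sf) *
              (w⁻¹ * (2 * ((0 : ℝ) - 1) * (M ^ (3 - 1) * (1 - M⁻¹ * M⁻¹))) - w⁻¹ * ((Lc ^ (3 + 1) * Lc ^ (3 + 1)) * B₁))))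
          + (((sf * sm)⁻¹ * (sf⁻¹ * sf⁻¹) * cE) * ((sf * sm)⁻¹ * (sf⁻¹ * sf⁻¹) * cE)) *
            ((-(1 / 2 : ℝ)) * (1 / 2 : ℝ) * ((sf * sf) *
              (w⁻¹ * (2 * ((0 : ℝ) - 1) * (M ^ (3 - 1) * (1 - M⁻¹ * M⁻¹))) - w⁻¹ * ((Lc ^ (3 + 1) * Lc ^ (3 + 1)) * B₂)))))
      = -4 * Lc ^ 8 * (M ^ 2 - 1) - Lc ^ 16 * (B₁ + B₂) := by
  subst hsf hsm hss hw hcE hcE₂ hc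
  field_simp
  ring

/-- [folklore] The same with `M = Lc·P`: the `W`-number is leaf-03's `−4·Lc⁸·(Lc²·P² − 1)` verbatim. -/
theorem pin_levelZero_crossed_period {Lc P sf sm ss w cE cE₂ c : ℝ} (hLc : Lc ≠ 0) (hP : P ≠ 0) (hsf : sf = 1) (hsm : sm = 1) (hss : ss = 1) (hw : w = 1)
    (hcE : cE = Lc ^ (3 + 1)) (hcE₂ : cE₂ = Lc ^ (2 * (3 + 1))) (hc : c = cE₂ * Lc ^ (2 * (3 + 1))) (B₁ B₂ : ℝ) :
    4 * ((c * -(((sf * sm) * (ss * Lc ^ (3 + 1))⁻¹) * ((sf * sm) * (ss * Lc ^ (3 + 1))⁻¹))) * (((sf * sm) * (ss * Lc ^ (3 + 1))⁻¹) * ((sf * sm) * (ss * Lc ^ (3 + 1))⁻¹))) *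
        ((((sf * sm)⁻¹ * (sf⁻¹ * sf⁻¹) * cE) * ((sf * sm)⁻¹ * (sf⁻¹ * sf⁻¹) * cE)) *
            ((-(1 / 2 : ℝ)) * (1 / 2 : ℝ) * ((sf * sf) *
              (w⁻¹ * (2 * ((0 : ℝ) - 1) * ((Lc * P) ^ (3 - 1) * (1 - (Lc * P)⁻¹ * (Lc * P)⁻¹))) - w⁻¹ * ((Lc ^ (3 + 1) * Lc ^ (3 + 1)) * B₁))))
          + (((sf * sm)⁻¹ * (sf⁻¹ * sf⁻¹) * cE) * ((sf * sm)⁻¹ * (sf⁻¹ * sf⁻¹) * cE)) *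
            ((-(1 / 2 : ℝ)) * (1 / 2 : ℝ) * ((sf * sf) *
              (w⁻¹ * (2 * ((0 : ℝ) - 1) * ((Lc * P) ^ (3 - 1) * (1 - (Lc * P)⁻¹ * (Lc * P)⁻¹))) - w⁻¹ * ((Lc ^ (3 + 1) * Lc ^ (3 + 1)) * B₂)))))
      = -4 * Lc ^ 8 * (Lc ^ 2 * P ^ 2 - 1) - Lc ^ 16 * (B₁ + B₂) := by
  rw [pin_levelZero_crossed hLc (mul_ne_zero hLc hP) hsf hsm hss hw hcE hcE₂ hc B₁ B₂]
  ring

end Summit.QuantumFields.BalabanUV.Beta.GAN24.FaceReadCrossedValueZeroPin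

end
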